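import Literature.Analysis.FluidPDE.LocalLerayPressureDecompositionHolds
import HarnessLib

/-!
# Joint measurability of the normalised pressure of the slices of a space–time field, `Lᵖ` class

Analysis/FluidPDE proof file (theorems only; no definitions, no named facts). The pressure of a
weak solution is built slice by slice from the velocity, `p(t, ·) = p̃[u(t)] = Σᵢⱼ ℛᵢℛⱼ(uᵢuⱼ)(t)`
(Tao's normalised pressure `normalisedPressure`, a pointwise principal value), and the space–time
formulations of the equations (`IsDistributionalNSSolutionOn`, the pressure clauses of
`IsSuitableWeakSolutionOn`, of Bradshaw–Tsai's `IsMollifiedPeriodicWeakSolution`, …) need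
`(t, x) ↦ p̃[u(t)](x)` as ONE jointly measurable function with a space–time `Lᵖ` bound. The tree
has the joint measurability for fields whose slices have *finite energy*
(`exists_stronglyMeasurable_normalisedPressure_eq`, `LocalLerayPressureDecompositionHolds`: at the
times where `|U(t)|² ∈ L¹`), and jointly measurable space–time *representatives* of the
`L³ → L^{3/2}` Riesz-pressure operator (`RieszPressureSpaceTime(Lp)`). This file gives the
statement on the natural Calderón–Zygmund class at a **general exponent** — slices with
`|U(t)|² ∈ Lᵖ(ℝ³)`, `1 < p < ∞` (e.g. `p = 5/3` for velocities in the energy class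
`L^{10/3}_{t,x}`: Bradshaw–Tsai 2017, proof of Thm. 2.4; `p = 3/2`, `5/4`) — for the pointwise
pressure `p̃[U(t)](x)` itself (no representative is needed: only a measurability witness):

* `continuousAt_truncatedPressureIntegral_of_memLp`, `exists_hasPressurePV_iff_rat_of_memLp` — for
  `|u|² ∈ Lᵖ` all truncations `∫_{|x-y|>ε} K(x-y)(u(y)) dy` are honest integrals
  (`integrableOn_pressureKernel_of_memLp`), continuous in `ε > 0` (dominated convergence, the
  sphere is null), so the principal value exists iff the truncations converge along the rationals;
* `exists_stronglyMeasurable_normalisedPressure_eq_of_memLp` — for a jointly (strongly)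
  measurable `U : ℝ × ℝ³ → ℝ³` there is a strongly measurable `g` on `ℝ × ℝ³` with
  `p̃[U(t)](x) = g(t, x)` for **every** `x` and every `t` with `|U(t)|² ∈ Lᵖ` (the set where
  countably many jointly measurable truncations converge along a countably generated filter is
  measurable and the limit is measurable — the argument of the finite-energy case verbatim);
* `aestronglyMeasurable_normalisedPressure_slab` — hence, for `U` a.e.-strongly measurable on a
  slab `I × ℝ³` with `|U(t)|² ∈ Lᵖ` for a.e. `t ∈ I`, the pointwise pressure
  `(t, x) ↦ p̃[U(t)](x)` is a.e.-strongly measurable on the slab (pass to a strongly measurable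
  modification: the principal value does not see null modifications of the slice,
  `normalisedPressure_congr_ae`);
* `lintegral_slab_normalisedPressure_rpow_le` — and **Stein's bound integrated in time**:
  `∫∫_{I×ℝ³} |p̃[U(t)](x)|ᵖ ≤ Cᵖ ∫∫_{I×ℝ³} |U|²ᵖ` (Tonelli and
  `stein1970_normalisedPressure_ae_Lp_bound_holds` slice-wise), i.e.
  `‖p̃[U]‖_{Lᵖ(I×ℝ³)} ≤ C ‖U‖²_{L²ᵖ(I×ℝ³)}` — for `p = 5/3` the printed
  "`‖p_ε‖_{L^{5/3}(ℝ³×[0,T])} ≤ C‖U_ε‖²_{L^{10/3}(ℝ³×[0,T])}`" of Bradshaw–Tsai.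

## Mathlib / tree search

Tree (all used): `truncatedPressureIntegral`, `HasPressurePV`, `normalisedPressure_eq`,
`normalisedPressure_eq_zero_of_not_exists` (`NormalisedPressure`);
`integrableOn_pressureKernel_of_memLp`, `aestronglyMeasurable_pressureKernel_sub_apply`,
`stein1970_normalisedPressure_ae_Lp_bound_holds` (`LocalLerayPressureDecompositionProofs`);
`stronglyMeasurable_truncatedPressureIntegral_uncurry`, `exists_tendsto_nhdsGT_iff_rat`,
`neBot_comap_ratCast_nhdsGT_zero`, `normalisedPressure_congr_ae` and the finite-energy model
`exists_stronglyMeasurable_normalisedPressure_eq` (`LocalLerayPressureDecompositionHolds`).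
`lean search 'stronglyMeasurable_normalisedPressure|rieszPressure.*slab|SpaceTime'`: only the
finite-energy statement and the `L³`-operator representatives
(`exists_spaceTime_rieszPressure(_of_memLp)`). Mathlib: `StronglyMeasurable.measurableSet_exists_tendsto`,
`StronglyMeasurable.limUnder`, `continuousAt_of_dominated`, `Measure.addHaar_sphere`,
`Measure.ae_ae_eq_curry_of_prod`, `lintegral_prod`.

## References

* E. M. Stein, *Singular integrals and differentiability properties of functions* (1970),
  Ch. II §4.2 Thm. 3, §4.5 Thm. 4. [Stein1971]
* Z. Bradshaw, T.-P. Tsai, Ann. Henri Poincaré 18 (2017), proof of Thm. 2.4 (the `L^{5/3}` bound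
  of the pressure). [BradshawTsai2017AHP]
* P. G. Lemarié-Rieusset, *The Navier–Stokes Problem in the 21st Century* (2016), Prop. 6.5 with
  Def. 6.9 (the pressure of an `L²ᵖ` very weak solution). [LemarieRieusset2016]
-/

noncomputable section

open MeasureTheory TopologicalSpace Set Function Filter Topology Metric
open scoped ENNReal NNReal RealInnerProductSpace

namespace Literature.Analysis.FluidPDE

-- nested operator types in the imported pressure files
set_option maxSynthPendingDepth 3


variable {p : ℝ≥0∞}

/-! ## §1. The principal value on the `Lᵖ` class: continuity in the radius, rational criterion -/

section PV

variable {u : (EuclideanSpace ℝ (Fin 3)) → (EuclideanSpace ℝ (Fin 3))}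

/-- **Continuity of the truncated singular integral in the truncation radius, `Lᵖ` class**: for
measurable `u` with `|u|² ∈ Lᵖ`, `1 < p < ∞`, and `ε₀ > 0`, `ε ↦ ∫_{|x-y|>ε} K(x-y)(u y) dy` is
continuous at `ε₀` (dominated convergence, domination by the absolutely convergent truncation at
radius `ε₀/2`, the sphere `|x - y| = ε₀` is null). [folklore] -/
theorem continuousAt_truncatedPressureIntegral_of_memLp (hp1 : 1 < p) (hp2 : p < ⊤)
    (hu : AEStronglyMeasurable u volume) (hu2 : MemLp (fun y => ‖u y‖ ^ 2) p volume) (x : (EuclideanSpace ℝ (Fin 3)))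
    {ε₀ : ℝ} (hε₀ : 0 < ε₀) : ContinuousAt (truncatedPressureIntegral u x) ε₀ := by
  -- conjugate exponent (integrability of the truncations)
  set q : ℝ≥0∞ := ENNReal.conjExponent p with hq
  haveI hpq : ENNReal.HolderConjugate p q := ENNReal.HolderConjugate.conjExponent hp1.le
  have hq1 : 1 < q := (ENNReal.HolderConjugate.lt_top_iff_one_lt p q).1 hp2
  have hqt : q ≠ ⊤ := (ENNReal.HolderConjugate.ne_top_iff_ne_one q p).2 (ne_of_gt hp1)
  set k : (EuclideanSpace ℝ (Fin 3)) → ℝ := fun y => pressureKernel (x - y) (u y) with hk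
  set F : ℝ → (EuclideanSpace ℝ (Fin 3)) → ℝ := fun ε y => ((closedBall x ε)ᶜ).indicator k y with hF
  have hrepr : truncatedPressureIntegral u x = fun ε => ∫ y, F ε y := by
    funext ε
    rw [truncatedPressureIntegral, hF]
    exact (integral_indicator measurableSet_closedBall.compl).symm
  rw [hrepr]
  have hkm : AEStronglyMeasurable k volume := aestronglyMeasurable_pressureKernel_sub_apply hu x
  set bound : (EuclideanSpace ℝ (Fin 3)) → ℝ := fun y => ((closedBall x (ε₀ / 2))ᶜ).indicator (fun y => ‖k y‖) y
    with hbound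
  refine continuousAt_of_dominated (bound := bound) ?_ ?_ ?_ ?_
  · exact Eventually.of_forall fun ε => hkm.indicator measurableSet_closedBall.compl
  · have hev : ∀ᶠ ε in 𝓝 ε₀, ε₀ / 2 < ε := Ioi_mem_nhds (by linarith)
    filter_upwards [hev] with ε hε
    refine Eventually.of_forall fun y => ?_
    rw [hF, hbound]
    dsimp only
    by_cases hy : y ∈ (closedBall x ε)ᶜ
    · have hy2 : y ∈ (closedBall x (ε₀ / 2))ᶜ := by
        rw [mem_compl_iff, mem_closedBall, not_le] at hy ⊢
        linarith
      rw [indicator_of_mem hy, indicator_of_mem hy2]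
    · rw [indicator_of_notMem hy, norm_zero]
      exact indicator_nonneg (fun _ _ => norm_nonneg _) _
  · rw [hbound]
    exact IntegrableOn.integrable_indicator
      ((integrableOn_pressureKernel_of_memLp hq1 hqt hu hu2 x (half_pos hε₀)).norm)
      measurableSet_closedBall.compl
  · have hsphere : ∀ᵐ y ∂(volume : Measure (EuclideanSpace ℝ (Fin 3))), y ∉ sphere x ε₀ :=
      measure_eq_zero_iff_ae_notMem.1 (Measure.addHaar_sphere volume x ε₀)
    filter_upwards [hsphere] with y hy
    rw [mem_sphere] at hy
    rcases lt_or_gt_of_ne hy with hlt | hgt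
    · -- `dist y x < ε₀`: the integrand vanishes for `ε` near `ε₀`
      have hev : ∀ᶠ ε in 𝓝 ε₀, dist y x < ε := Ioi_mem_nhds hlt
      refine Filter.EventuallyEq.continuousAt (y := (0 : ℝ)) ?_
      filter_upwards [hev] with ε hε
      rw [hF]
      dsimp only
      rw [indicator_of_notMem]
      rw [mem_compl_iff, mem_closedBall, not_le, not_lt]
      exact hε.le
    · -- `ε₀ < dist y x`: the integrand is `k y` for `ε` near `ε₀`
      have hev : ∀ᶠ ε in 𝓝 ε₀, ε < dist y x := Iio_mem_nhds hgt
      refine Filter.EventuallyEq.continuousAt (y := k y) ?_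
      filter_upwards [hev] with ε hε
      rw [hF]
      dsimp only
      rw [indicator_of_mem]
      rw [mem_compl_iff, mem_closedBall, not_le]
      exact hε

/-- **The principal value exists iff the truncated integrals converge along the rationals,
`Lᵖ` class** (`|u|² ∈ Lᵖ`, `1 < p < ∞`: all truncations are integrable and the truncated integral
is continuous in the radius). [folklore] -/
theorem exists_hasPressurePV_iff_rat_of_memLp (hp1 : 1 < p) (hp2 : p < ⊤)
    (hu : AEStronglyMeasurable u volume) (hu2 : MemLp (fun y => ‖u y‖ ^ 2) p volume) (x : (EuclideanSpace ℝ (Fin 3))) :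
    (∃ L, HasPressurePV u x L) ↔
      ∃ L, Tendsto (fun q : ℚ => truncatedPressureIntegral u x q)
        (comap (fun q : ℚ => (q : ℝ)) (𝓝[>] (0 : ℝ))) (𝓝 L) := by
  set q : ℝ≥0∞ := ENNReal.conjExponent p with hq
  haveI hpq : ENNReal.HolderConjugate p q := ENNReal.HolderConjugate.conjExponent hp1.le
  have hq1 : 1 < q := (ENNReal.HolderConjugate.lt_top_iff_one_lt p q).1 hp2
  have hqt : q ≠ ⊤ := (ENNReal.HolderConjugate.ne_top_iff_ne_one q p).2 (ne_of_gt hp1)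
  rw [← exists_tendsto_nhdsGT_iff_rat
    (fun ε hε => continuousAt_truncatedPressureIntegral_of_memLp hp1 hp2 hu hu2 x hε)]
  constructor
  · rintro ⟨L, -, hL⟩
    exact ⟨L, hL⟩
  · rintro ⟨L, hL⟩
    refine ⟨L, ?_, hL⟩
    filter_upwards [self_mem_nhdsWithin] with ε hε
    exact integrableOn_pressureKernel_of_memLp hq1 hqt hu hu2 x hε

end PV

/-! ## §2. A strongly measurable witness for the pressure of the slices, `Lᵖ` class -/

section SliceMeasurability

variable {U : ℝ → (EuclideanSpace ℝ (Fin 3)) → (EuclideanSpace ℝ (Fin 3))}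

/-- **A strongly measurable modification of the normalised pressure of the slices, `Lᵖ` class.**
For a jointly measurable field `U : ℝ × ℝ³ → ℝ³` and `1 < p < ∞` there is a strongly measurable
`g : ℝ × ℝ³ → ℝ` with `p̃[U(t)](x) = g(t, x)` for *every* `x` and every `t` at which
`|U(t)|² ∈ Lᵖ` (at such `t` the principal value exists iff the truncated integrals converge along
the rationals, `exists_hasPressurePV_iff_rat_of_memLp`; the set of convergence of countably many
jointly measurable functions along a countably generated filter is measurable,
`measurableSet_exists_tendsto`, and the limit is measurable, `StronglyMeasurable.limUnder` — the
finite-energy `exists_stronglyMeasurable_normalisedPressure_eq` verbatim). [folklore] -/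
theorem exists_stronglyMeasurable_normalisedPressure_eq_of_memLp (hp1 : 1 < p) (hp2 : p < ⊤)
    (hU : StronglyMeasurable (uncurry U)) {G : Set ℝ}
    (hint : ∀ t ∈ G, MemLp (fun y => ‖U t y‖ ^ 2) p volume) :
    ∃ g : ℝ × (EuclideanSpace ℝ (Fin 3)) → ℝ, StronglyMeasurable g ∧
      ∀ t ∈ G, ∀ x, normalisedPressure (U t) x = g (t, x) := by
  set l : Filter ℚ := comap (fun q : ℚ => (q : ℝ)) (𝓝[>] (0 : ℝ)) with hl
  haveI : l.NeBot := neBot_comap_ratCast_nhdsGT_zero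
  set Tq : ℚ → ℝ × (EuclideanSpace ℝ (Fin 3)) → ℝ := fun q z => truncatedPressureIntegral (U z.1) z.2 q with hTq
  have hTqm : ∀ q, StronglyMeasurable (Tq q) := fun q =>
    stronglyMeasurable_truncatedPressureIntegral_uncurry hU q
  set Ev : Set (ℝ × (EuclideanSpace ℝ (Fin 3))) := {z | ∃ c, Tendsto (fun q => Tq q z) l (𝓝 c)} with hEv
  have hEvm : MeasurableSet Ev := MeasureTheory.StronglyMeasurable.measurableSet_exists_tendsto hTqm
  set g : ℝ × (EuclideanSpace ℝ (Fin 3)) → ℝ := fun z =>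
    Ev.indicator (fun z => -‖U z.1 z.2‖ ^ 2 / 3 + limUnder l (fun q => Tq q z)) z with hg
  have hlim : StronglyMeasurable fun z : ℝ × (EuclideanSpace ℝ (Fin 3)) => limUnder l (fun q => Tq q z) :=
    MeasureTheory.StronglyMeasurable.limUnder hTqm
  have hgm : StronglyMeasurable g := by
    refine StronglyMeasurable.indicator ?_ hEvm
    have h1 : Measurable fun z : ℝ × (EuclideanSpace ℝ (Fin 3)) => -‖U z.1 z.2‖ ^ 2 / 3 :=
      ((hU.measurable.norm.pow_const 2).neg.div_const 3)
    exact (h1.add hlim.measurable).stronglyMeasurable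
  refine ⟨g, hgm, fun t ht x => ?_⟩
  have hslice : AEStronglyMeasurable (U t) volume :=
    (hU.comp_measurable measurable_prodMk_left).aestronglyMeasurable
  have hiff := exists_hasPressurePV_iff_rat_of_memLp hp1 hp2 hslice (hint t ht) x
  by_cases hex : ∃ L, HasPressurePV (U t) x L
  · obtain ⟨L, hL⟩ := hex
    have hmem : (t, x) ∈ Ev := hiff.1 ⟨L, hL⟩
    have hconv : Tendsto (fun q => Tq q (t, x)) l (𝓝 L) := hL.2.comp tendsto_comap
    rw [normalisedPressure_eq hL, finrank_euclideanSpace_fin, hg]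
    dsimp only
    rw [indicator_of_mem hmem, hconv.limUnder_eq]
    push_cast
    ring
  · have hnmem : (t, x) ∉ Ev := fun h => hex (hiff.2 h)
    rw [normalisedPressure_eq_zero_of_not_exists hex, hg]
    dsimp only
    rw [indicator_of_notMem hnmem]

/-- **Strongly measurable modification of a space–time field on a slab, with a.e. slices**: if
`uncurry U` is a.e.-strongly measurable on `I × ℝ³` then there is a jointly strongly measurable
`Ũ` with `U = Ũ` a.e. on the slab and `U(t) = Ũ(t)` a.e. on `ℝ³` for a.e. `t ∈ I`
(`AEStronglyMeasurable.mk` and `Measure.ae_ae_eq_curry_of_prod`). [folklore] -/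
theorem exists_stronglyMeasurable_slices_ae_eq {I : Set ℝ}
    (hU : AEStronglyMeasurable (uncurry U) (volume.restrict (I ×ˢ (univ : Set (EuclideanSpace ℝ (Fin 3)))))) :
    ∃ Uc : ℝ → (EuclideanSpace ℝ (Fin 3)) → (EuclideanSpace ℝ (Fin 3)), StronglyMeasurable (uncurry Uc) ∧
      (uncurry U =ᵐ[volume.restrict (I ×ˢ (univ : Set (EuclideanSpace ℝ (Fin 3))))] uncurry Uc) ∧
      ∀ᵐ t ∂(volume.restrict I), ∀ᵐ y : (EuclideanSpace ℝ (Fin 3)), U t y = Uc t y := by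
  set V : ℝ × (EuclideanSpace ℝ (Fin 3)) → (EuclideanSpace ℝ (Fin 3)) := hU.mk (uncurry U) with hV
  have hVm : StronglyMeasurable V := hU.stronglyMeasurable_mk
  have hUV : uncurry U =ᵐ[volume.restrict (I ×ˢ (univ : Set (EuclideanSpace ℝ (Fin 3))))] V := hU.ae_eq_mk
  have hprod : (volume.restrict (I ×ˢ (univ : Set (EuclideanSpace ℝ (Fin 3)))) : Measure (ℝ × (EuclideanSpace ℝ (Fin 3)))) =
      (volume.restrict I).prod (volume : Measure (EuclideanSpace ℝ (Fin 3))) := by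
    rw [Measure.volume_eq_prod, ← Measure.restrict_prod_eq_prod_univ]
  refine ⟨curry V, by rw [uncurry_curry]; exact hVm, by rw [uncurry_curry]; exact hUV, ?_⟩
  have hUV' : ∀ᵐ z ∂((volume.restrict I).prod (volume : Measure (EuclideanSpace ℝ (Fin 3)))), uncurry U z = V z := by
    rw [← hprod]; exact hUV
  have h := Measure.ae_ae_eq_curry_of_prod hUV'
  filter_upwards [h] with t ht
  filter_upwards [ht] with y hy
  exact hy

/-- **The pointwise pressure of the slices is a.e.-strongly measurable on a slab.** Let
`1 < p < ∞`, `I ⊆ ℝ`, `U : ℝ → ℝ³ → ℝ³` with `uncurry U` a.e.-strongly measurable on `I × ℝ³` and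
`|U(t)|² ∈ Lᵖ` for a.e. `t ∈ I`. Then `(t, x) ↦ p̃[U(t)](x)` is a.e.-strongly measurable on
`I × ℝ³`: replace `U` by a strongly measurable modification `Ũ` on the slab; for a.e. `t ∈ I` the
slices agree a.e., so `p̃[U(t)](x) = p̃[Ũ(t)](x)` at every `x` with `U(t,x) = Ũ(t,x)`
(`normalisedPressure_congr_ae`), i.e. a.e. on the slab (the exceptional set is contained in the
union of the null set `{U ≠ Ũ}` and of `N × ℝ³`, `N` the null set of bad times — no Fubini for
non-measurable sets is needed), and `p̃[Ũ(t)](x)` has the strongly measurable witness of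
`exists_stronglyMeasurable_normalisedPressure_eq_of_memLp`. [folklore] -/
theorem aestronglyMeasurable_normalisedPressure_slab (hp1 : 1 < p) (hp2 : p < ⊤) {I : Set ℝ}
    (hU : AEStronglyMeasurable (uncurry U) (volume.restrict (I ×ˢ (univ : Set (EuclideanSpace ℝ (Fin 3))))))
    (hUp : ∀ᵐ t ∂(volume.restrict I), MemLp (fun y => ‖U t y‖ ^ 2) p volume) :
    AEStronglyMeasurable (fun z : ℝ × (EuclideanSpace ℝ (Fin 3)) => normalisedPressure (U z.1) z.2)
      (volume.restrict (I ×ˢ (univ : Set (EuclideanSpace ℝ (Fin 3))))) := by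
  have hprod : (volume.restrict (I ×ˢ (univ : Set (EuclideanSpace ℝ (Fin 3)))) : Measure (ℝ × (EuclideanSpace ℝ (Fin 3)))) =
      (volume.restrict I).prod (volume : Measure (EuclideanSpace ℝ (Fin 3))) := by
    rw [Measure.volume_eq_prod, ← Measure.restrict_prod_eq_prod_univ]
  obtain ⟨Uc, hUcm, hUUc, hslices⟩ := exists_stronglyMeasurable_slices_ae_eq hU
  -- the good times and the witness
  set G : Set ℝ := {t | MemLp (fun y => ‖Uc t y‖ ^ 2) p volume} with hG
  obtain ⟨g, hgm, hg⟩ := exists_stronglyMeasurable_normalisedPressure_eq_of_memLp hp1 hp2 hUcm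
    (G := G) (fun t ht => ht)
  have hGood : ∀ᵐ t ∂(volume.restrict I), t ∈ G ∧ ∀ᵐ y : (EuclideanSpace ℝ (Fin 3)), U t y = Uc t y := by
    filter_upwards [hUp, hslices] with t ht hts
    refine ⟨?_, hts⟩
    change MemLp (fun y => ‖Uc t y‖ ^ 2) p volume
    refine ht.ae_eq ?_
    filter_upwards [hts] with y hy
    rw [hy]
  -- the exceptional times form a null set, hence so does their cylinder
  have hbad : (volume.restrict (I ×ˢ (univ : Set (EuclideanSpace ℝ (Fin 3)))))
      ({t | ¬(t ∈ G ∧ ∀ᵐ y : (EuclideanSpace ℝ (Fin 3)), U t y = Uc t y)} ×ˢ (univ : Set (EuclideanSpace ℝ (Fin 3)))) = 0 := by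
    rw [hprod, Measure.prod_prod, ae_iff.1 hGood, zero_mul]
  -- a.e. on the slab, the pointwise pressure is `g`
  have hae : (fun z : ℝ × (EuclideanSpace ℝ (Fin 3)) => normalisedPressure (U z.1) z.2) =ᵐ[volume.restrict (I ×ˢ (univ : Set (EuclideanSpace ℝ (Fin 3))))]
      g := by
    filter_upwards [measure_eq_zero_iff_ae_notMem.1 hbad, hUUc] with z hz hzV
    obtain ⟨t, y⟩ := z
    have hgood : t ∈ G ∧ ∀ᵐ y : (EuclideanSpace ℝ (Fin 3)), U t y = Uc t y := by
      by_contra h'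
      exact hz ⟨h', mem_univ _⟩
    obtain ⟨htG, hts⟩ := hgood
    have hy : U t y = Uc t y := hzV
    change normalisedPressure (U t) y = g (t, y)
    rw [normalisedPressure_congr_ae hts hy]
    exact hg t htG y
  exact hgm.aestronglyMeasurable.congr hae.symm

end SliceMeasurability

/-! ## §3. Stein's bound integrated in time on a slab -/

section SlabBound

variable {U : ℝ → (EuclideanSpace ℝ (Fin 3)) → (EuclideanSpace ℝ (Fin 3))}

/-- `‖(‖v‖²)‖ₑ ^ r = ‖v‖ₑ ^ (2r)`. [folklore] -/
theorem enorm_norm_sq_rpow (v : (EuclideanSpace ℝ (Fin 3))) (r : ℝ) :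
    ‖‖v‖ ^ 2‖ₑ ^ r = ‖v‖ₑ ^ (2 * r) := by
  rw [Real.enorm_eq_ofReal (sq_nonneg _), ENNReal.ofReal_pow (norm_nonneg _), ofReal_norm,
    ← ENNReal.rpow_natCast, ← ENNReal.rpow_mul]
  norm_num


/-- **Stein's bound integrated in time on a slab.** Let `1 < p < ∞`. There is `C = C_p` (the
constant of `stein1970_normalisedPressure_ae_Lp_bound_holds`) such that for every `I ⊆ ℝ` and
every `U : ℝ → ℝ³ → ℝ³` with `uncurry U` a.e.-strongly measurable on `I × ℝ³` and `|U(t)|² ∈ Lᵖ`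
for a.e. `t ∈ I`,
`∫∫_{I×ℝ³} |p̃[U(t)](x)|^p ≤ C^p ∫∫_{I×ℝ³} |U(t,x)|^{2p}` (Tonelli on both sides and
`‖p̃[U(t)]‖_p ≤ C ‖|U(t)|²‖_p` slice-wise; Bradshaw–Tsai 2017, proof of Thm. 2.4 at `p = 5/3`:
"`‖p_ε‖_{L^{5/3}(ℝ³×[0,T])} ≤ C‖U_ε‖²_{L^{10/3}(ℝ³×[0,T])}` … apply the Calderon–Zygmund
theory"). [cite: Stein1971, Ch. II §4.2 Thm 3 (b); BradshawTsai2017AHP, proof of Thm 2.4 (the L^{5/3} pressure bound)] -/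
theorem lintegral_slab_normalisedPressure_rpow_le (hp1 : 1 < p) (hp2 : p < ⊤) :
    ∃ C : ℝ≥0, ∀ (I : Set ℝ) (U : ℝ → (EuclideanSpace ℝ (Fin 3)) → (EuclideanSpace ℝ (Fin 3))),
      AEStronglyMeasurable (uncurry U) (volume.restrict (I ×ˢ (univ : Set (EuclideanSpace ℝ (Fin 3))))) →
      (∀ᵐ t ∂(volume.restrict I), MemLp (fun y => ‖U t y‖ ^ 2) p volume) →
      ∫⁻ z in I ×ˢ (univ : Set (EuclideanSpace ℝ (Fin 3))), ‖normalisedPressure (U z.1) z.2‖ₑ ^ p.toReal ≤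
        (C : ℝ≥0∞) ^ p.toReal * ∫⁻ z in I ×ˢ (univ : Set (EuclideanSpace ℝ (Fin 3))), ‖U z.1 z.2‖ₑ ^ (2 * p.toReal) := by
  obtain ⟨C, hC⟩ := stein1970_normalisedPressure_ae_Lp_bound_holds p hp1 hp2
  refine ⟨C, fun I U hU hUp => ?_⟩
  have hp0 : p ≠ 0 := (zero_lt_one.trans hp1).ne'
  have hpt : p ≠ ⊤ := hp2.ne
  have hr : 0 < p.toReal := ENNReal.toReal_pos hp0 hpt
  have hprod : (volume.restrict (I ×ˢ (univ : Set (EuclideanSpace ℝ (Fin 3)))) : Measure (ℝ × (EuclideanSpace ℝ (Fin 3)))) =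
      (volume.restrict I).prod (volume : Measure (EuclideanSpace ℝ (Fin 3))) := by
    rw [Measure.volume_eq_prod, ← Measure.restrict_prod_eq_prod_univ]
  -- measurability of the two integrands on the slab
  have hPm : AEStronglyMeasurable (fun z : ℝ × (EuclideanSpace ℝ (Fin 3)) => normalisedPressure (U z.1) z.2)
      ((volume.restrict I).prod (volume : Measure (EuclideanSpace ℝ (Fin 3)))) := by
    rw [← hprod]; exact aestronglyMeasurable_normalisedPressure_slab hp1 hp2 hU hUp
  have hUm : AEStronglyMeasurable (uncurry U) ((volume.restrict I).prod (volume : Measure (EuclideanSpace ℝ (Fin 3)))) := by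
    rw [← hprod]; exact hU
  -- slices: measurability and Stein's bound for a.e. `t ∈ I`
  obtain ⟨Uc, hUcm, -, hslices⟩ := exists_stronglyMeasurable_slices_ae_eq hU
  have hslice : ∀ᵐ t ∂(volume.restrict I),
      ∫⁻ y, ‖normalisedPressure (U t) y‖ₑ ^ p.toReal ≤
        (C : ℝ≥0∞) ^ p.toReal * ∫⁻ y, ‖U t y‖ₑ ^ (2 * p.toReal) := by
    filter_upwards [hUp, hslices] with t ht hts
    have hUt : AEStronglyMeasurable (U t) volume :=
      (hUcm.comp_measurable measurable_prodMk_left).aestronglyMeasurable.congr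
        (hts.mono fun y hy => hy.symm)
    have hst := (hC (U t) hUt ht).2
    -- raise to the power `p` and rewrite both norms as integrals
    have h1 : ∫⁻ y, ‖normalisedPressure (U t) y‖ₑ ^ p.toReal =
        eLpNorm (normalisedPressure (U t)) p volume ^ p.toReal := by
      rw [eLpNorm_eq_lintegral_rpow_enorm_toReal hp0 hpt, ← ENNReal.rpow_mul, one_div_mul_cancel hr.ne',
        ENNReal.rpow_one]
    have h2 : eLpNorm (fun y => ‖U t y‖ ^ 2) p volume ^ p.toReal = ∫⁻ y, ‖U t y‖ₑ ^ (2 * p.toReal) := by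
      rw [eLpNorm_eq_lintegral_rpow_enorm_toReal hp0 hpt, ← ENNReal.rpow_mul, one_div_mul_cancel hr.ne',
        ENNReal.rpow_one]
      exact lintegral_congr fun y => enorm_norm_sq_rpow (U t y) _
    rw [h1, ← h2, ← ENNReal.mul_rpow_of_nonneg _ _ hr.le]
    exact ENNReal.rpow_le_rpow hst hr.le
  -- Tonelli on both sides
  calc ∫⁻ z in I ×ˢ (univ : Set (EuclideanSpace ℝ (Fin 3))), ‖normalisedPressure (U z.1) z.2‖ₑ ^ p.toReal
      = ∫⁻ t in I, ∫⁻ y, ‖normalisedPressure (U t) y‖ₑ ^ p.toReal := by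
        rw [hprod, lintegral_prod _ (hPm.enorm.pow_const _)]
    _ ≤ ∫⁻ t in I, (C : ℝ≥0∞) ^ p.toReal * ∫⁻ y, ‖U t y‖ₑ ^ (2 * p.toReal) :=
        lintegral_mono_ae hslice
    _ = (C : ℝ≥0∞) ^ p.toReal * ∫⁻ t in I, ∫⁻ y, ‖U t y‖ₑ ^ (2 * p.toReal) := by
        rw [lintegral_const_mul' _ _ (ENNReal.rpow_ne_top_of_nonneg hr.le ENNReal.coe_ne_top)]
    _ = (C : ℝ≥0∞) ^ p.toReal * ∫⁻ z in I ×ˢ (univ : Set (EuclideanSpace ℝ (Fin 3))), ‖U z.1 z.2‖ₑ ^ (2 * p.toReal) := by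
        rw [hprod, lintegral_prod (fun z : ℝ × (EuclideanSpace ℝ (Fin 3)) => ‖U z.1 z.2‖ₑ ^ (2 * p.toReal))
          (hUm.enorm.pow_const _)]

end SlabBound


end Literature.Analysis.FluidPDE
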